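import Mathlib.Analysis.SpecialFunctions.ExpDeriv
import Mathlib.Analysis.SpecialFunctions.Trigonometric.Basic
import Mathlib.Analysis.InnerProductSpace.Basic
import Mathlib.Analysis.Complex.Exponential
import Mathlib.MeasureTheory.Integral.Lebesgue.Countable
import Mathlib.MeasureTheory.Integral.Lebesgue.Add
import Mathlib.Analysis.SpecificLimits.Basic
import HarnessLib

/-!
# Route `CylinderEntropy`, item `ImmortalAreaToFloor` (stmt-SmoothPoincare4-17197):
# elementary Gaussian bookkeeping, I: tails, balls, two centres (modules Γ3/Γ4/Γ6 of
# `BLUEPRINT-17197-c2.md`)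

Pure measure theory / real analysis, no geometry.  Throughout, `β` is a measure on a measurable
space `α`, `d : α → ℝ` a measurable non-negative "distance to the centre", and the backward heat
kernel profile of `ℝ⁴` at scale `s > 0` is `G_s = exp(-d²/(4s)) / (4πs)²`.
* `gaussian_tail_pointwise` / `setLIntegral_gaussian_tail_le` — TAILS BY DOUBLING THE SCALE: on
  `{ρ ≤ d}`, `G_s ≤ 4 e^{-ρ²/(8s)} G_{2s}`, hence `∫_{ρ ≤ d} G_s dβ ≤ 4 e^{-ρ²/(8s)} ∫ G_{2s} dβ`;
* `measure_le_mul_lintegral_gaussian` — BALLS FROM GAUSSIANS: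
  `β{d ≤ r} ≤ 16π² e^{1/4} r⁴ ∫ G_{r²} dβ`;
* `norm_sub_sq_le_midpoint` / `gaussian_midpoint_comparison` — TWO CENTRES: for `σ = τ/(1+η)`,
  `(1+η)⁻² e^{-(1+η⁻¹)‖x-p‖²/(4τ)} G_{x,σ}(y) ≤ G_{p,τ}(y)` (Young's inequality on `‖y - p‖²`), the
  device turning two separated full sheets into Gaussian density `≈ 2` at the midpoint.

References: W. K. Allard, Ann. of Math. 95 (1972) §6 (density bounds); T. H. Colding,
W. P. Minicozzi II, Ann. of Math. 175 (2012) §7 (Gaussian densities versus area ratios).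
-/

noncomputable section

-- the prescribed namespace `Summit.SmoothPoincare4.SmoothPoincare4.…` repeats `SmoothPoincare4`
set_option linter.dupNamespace false

open MeasureTheory Set Filter Real
open scoped ENNReal NNReal Topology BigOperators

namespace Summit.SmoothPoincare4.SmoothPoincare4.Theorems.GaussianBounds

/-! ## Tails by doubling the scale -/

/-- **Gaussian tail by doubling the scale, pointwise**: for `0 < s`, `ρ ≤ δ` (`0 ≤ ρ`):
`e^{-δ²/(4s)}/(4πs)² ≤ 4 e^{-ρ²/(8s)} · e^{-δ²/(4·2s)}/(4π·2s)²`. [folklore] -/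
theorem gaussian_tail_pointwise {s ρ δ : ℝ} (hs : 0 < s) (hρ : 0 ≤ ρ) (hρδ : ρ ≤ δ) :
    Real.exp (-δ ^ 2 / (4 * s)) / (4 * Real.pi * s) ^ 2 ≤
      4 * Real.exp (-ρ ^ 2 / (8 * s)) * (Real.exp (-δ ^ 2 / (4 * (2 * s))) / (4 * Real.pi * (2 * s)) ^ 2) := by
  have hπ := Real.pi_pos
  have hden : 0 < (4 * Real.pi * s) ^ 2 := by positivity
  have hkey : Real.exp (-δ ^ 2 / (4 * s)) ≤ Real.exp (-ρ ^ 2 / (8 * s)) * Real.exp (-δ ^ 2 / (4 * (2 * s))) := by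
    rw [← Real.exp_add]
    apply Real.exp_le_exp.2
    have h1 : ρ ^ 2 ≤ δ ^ 2 := pow_le_pow_left₀ hρ hρδ 2
    have h2 : -δ ^ 2 / (4 * s) = -δ ^ 2 / (8 * s) + -δ ^ 2 / (8 * s) := by field_simp; ring
    have h3 : -δ ^ 2 / (4 * (2 * s)) = -δ ^ 2 / (8 * s) := by ring_nf
    rw [h2, h3]
    have h4 : -δ ^ 2 / (8 * s) ≤ -ρ ^ 2 / (8 * s) := by
      apply div_le_div_of_nonneg_right _ (by positivity)
      linarith
    linarith
  have hrew : 4 * Real.exp (-ρ ^ 2 / (8 * s)) * (Real.exp (-δ ^ 2 / (4 * (2 * s))) / (4 * Real.pi * (2 * s)) ^ 2)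
      = (Real.exp (-ρ ^ 2 / (8 * s)) * Real.exp (-δ ^ 2 / (4 * (2 * s)))) / (4 * Real.pi * s) ^ 2 := by
    field_simp
    ring
  rw [hrew]
  exact div_le_div_of_nonneg_right hkey hden.le

variable {α : Type*} [MeasurableSpace α]

/-- **Gaussian tail by doubling the scale**: for a measure `β`, a measurable `d ≥ 0`, `0 < s` and
`0 ≤ ρ`: `∫_{ρ ≤ d} G_s dβ ≤ 4 e^{-ρ²/(8s)} ∫ G_{2s} dβ`, `G_s = e^{-d²/(4s)}/(4πs)²`. [folklore] -/
theorem setLIntegral_gaussian_tail_le (β : Measure α) {d : α → ℝ} (hd : Measurable d) {s ρ : ℝ}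
    (hs : 0 < s) (hρ : 0 ≤ ρ) :
    ∫⁻ a in {a | ρ ≤ d a}, ENNReal.ofReal (Real.exp (-(d a) ^ 2 / (4 * s)) / (4 * Real.pi * s) ^ 2) ∂β ≤
      ENNReal.ofReal (4 * Real.exp (-ρ ^ 2 / (8 * s))) *
        ∫⁻ a, ENNReal.ofReal (Real.exp (-(d a) ^ 2 / (4 * (2 * s))) / (4 * Real.pi * (2 * s)) ^ 2) ∂β := by
  have hmeas : MeasurableSet {a | ρ ≤ d a} := measurableSet_le measurable_const hd
  calc ∫⁻ a in {a | ρ ≤ d a}, ENNReal.ofReal (Real.exp (-(d a) ^ 2 / (4 * s)) / (4 * Real.pi * s) ^ 2) ∂β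
      ≤ ∫⁻ a in {a | ρ ≤ d a}, ENNReal.ofReal (4 * Real.exp (-ρ ^ 2 / (8 * s))) *
          ENNReal.ofReal (Real.exp (-(d a) ^ 2 / (4 * (2 * s))) / (4 * Real.pi * (2 * s)) ^ 2) ∂β := by
        refine setLIntegral_mono' hmeas fun a ha => ?_
        rw [← ENNReal.ofReal_mul (by positivity)]
        exact ENNReal.ofReal_le_ofReal (gaussian_tail_pointwise hs hρ ha)
    _ = ENNReal.ofReal (4 * Real.exp (-ρ ^ 2 / (8 * s))) *
          ∫⁻ a in {a | ρ ≤ d a}, ENNReal.ofReal (Real.exp (-(d a) ^ 2 / (4 * (2 * s))) /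
            (4 * Real.pi * (2 * s)) ^ 2) ∂β := by
        rw [lintegral_const_mul' _ _ ENNReal.ofReal_ne_top]
    _ ≤ _ := by
        gcongr
        exact Measure.restrict_le_self

/-! ## Balls from Gaussians -/

/-- **Mass of a ball from the Gaussian density at the matching scale**: for `0 < r`,
`β{d ≤ r} ≤ 16π² e^{1/4} r⁴ · ∫ G_{r²} dβ` (on `{d ≤ r}`, `G_{r²} ≥ e^{-1/4}/(16π²r⁴)`).
[cite: ColdingMinicozzi2012, §7] -/
theorem measure_le_mul_lintegral_gaussian (β : Measure α) {d : α → ℝ} (hd : Measurable d)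
    (hd0 : ∀ a, 0 ≤ d a) {r : ℝ} (hr : 0 < r) :
    β {a | d a ≤ r} ≤ ENNReal.ofReal (16 * Real.pi ^ 2 * Real.exp (1 / 4) * r ^ 4) *
      ∫⁻ a, ENNReal.ofReal (Real.exp (-(d a) ^ 2 / (4 * r ^ 2)) / (4 * Real.pi * r ^ 2) ^ 2) ∂β := by
  have hπ := Real.pi_pos
  have hmeas : MeasurableSet {a | d a ≤ r} := measurableSet_le hd measurable_const
  set c : ℝ := Real.exp (-(1 / 4 : ℝ)) / (4 * Real.pi * r ^ 2) ^ 2 with hc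
  have hc0 : 0 < c := by positivity
  -- on the ball the kernel is at least `c`
  have hlow : ∀ a ∈ {a | d a ≤ r}, ENNReal.ofReal c ≤
      ENNReal.ofReal (Real.exp (-(d a) ^ 2 / (4 * r ^ 2)) / (4 * Real.pi * r ^ 2) ^ 2) := by
    intro a ha
    refine ENNReal.ofReal_le_ofReal (div_le_div_of_nonneg_right (Real.exp_le_exp.2 ?_) (by positivity))
    have h1 : (d a) ^ 2 ≤ r ^ 2 := pow_le_pow_left₀ (hd0 a) ha 2
    have h2 : (d a) ^ 2 / (4 * r ^ 2) ≤ 1 / 4 := by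
      rw [div_le_div_iff₀ (by positivity) (by norm_num)]
      linarith
    have h3 : -(d a) ^ 2 / (4 * r ^ 2) = -((d a) ^ 2 / (4 * r ^ 2)) := by ring
    rw [h3]
    linarith
  have h1 : ENNReal.ofReal c * β {a | d a ≤ r} ≤
      ∫⁻ a, ENNReal.ofReal (Real.exp (-(d a) ^ 2 / (4 * r ^ 2)) / (4 * Real.pi * r ^ 2) ^ 2) ∂β :=
    calc ENNReal.ofReal c * β {a | d a ≤ r} = ∫⁻ _ in {a | d a ≤ r}, ENNReal.ofReal c ∂β := by
          rw [setLIntegral_const, mul_comm]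
      _ ≤ ∫⁻ a in {a | d a ≤ r}, ENNReal.ofReal (Real.exp (-(d a) ^ 2 / (4 * r ^ 2)) /
            (4 * Real.pi * r ^ 2) ^ 2) ∂β := setLIntegral_mono' hmeas hlow
      _ ≤ _ := setLIntegral_le_lintegral _ _
  -- divide by `c`: `1/c = 16π² e^{1/4} r⁴`
  have hinv : ENNReal.ofReal (16 * Real.pi ^ 2 * Real.exp (1 / 4) * r ^ 4) = (ENNReal.ofReal c)⁻¹ := by
    rw [← ENNReal.ofReal_inv_of_pos hc0]
    congr 1
    rw [hc, inv_div, Real.exp_neg]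
    field_simp
    ring
  have hc0' : ENNReal.ofReal c ≠ 0 := by rwa [Ne, ENNReal.ofReal_eq_zero, not_le]
  calc β {a | d a ≤ r} = (ENNReal.ofReal c)⁻¹ * (ENNReal.ofReal c * β {a | d a ≤ r}) := by
        rw [← mul_assoc, ENNReal.inv_mul_cancel hc0' ENNReal.ofReal_ne_top, one_mul]
    _ ≤ (ENNReal.ofReal c)⁻¹ * ∫⁻ a, ENNReal.ofReal (Real.exp (-(d a) ^ 2 / (4 * r ^ 2)) /
          (4 * Real.pi * r ^ 2) ^ 2) ∂β := by gcongr
    _ = _ := by rw [hinv]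

/-! ## Two centres -/

/-- **Young's inequality for the distance to a midpoint**: in a real inner product space,
`‖y - p‖² ≤ (1 + η) ‖y - x‖² + (1 + η⁻¹) ‖x - p‖²` for `η > 0`. [folklore] -/
theorem norm_sub_sq_le_midpoint {E : Type*} [NormedAddCommGroup E] [InnerProductSpace ℝ E]
    (y x p : E) {η : ℝ} (hη : 0 < η) :
    ‖y - p‖ ^ 2 ≤ (1 + η) * ‖y - x‖ ^ 2 + (1 + η⁻¹) * ‖x - p‖ ^ 2 := by
  have htri : ‖y - p‖ ≤ ‖y - x‖ + ‖x - p‖ := by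
    have : y - p = (y - x) + (x - p) := by abel
    rw [this]; exact norm_add_le _ _
  have ha := norm_nonneg (y - x)
  have hb := norm_nonneg (x - p)
  have h1 : ‖y - p‖ ^ 2 ≤ (‖y - x‖ + ‖x - p‖) ^ 2 := pow_le_pow_left₀ (norm_nonneg _) htri 2
  -- `2ab ≤ η a² + η⁻¹ b²`
  have hη0 : η ≠ 0 := hη.ne'
  have h2 : 2 * ‖y - x‖ * ‖x - p‖ ≤ η * ‖y - x‖ ^ 2 + η⁻¹ * ‖x - p‖ ^ 2 := by
    rw [← sub_nonneg]
    have hrepr : η * ‖y - x‖ ^ 2 + η⁻¹ * ‖x - p‖ ^ 2 - 2 * ‖y - x‖ * ‖x - p‖ =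
        η⁻¹ * (η * ‖y - x‖ - ‖x - p‖) ^ 2 := by
      field_simp
      ring
    rw [hrepr]
    positivity
  nlinarith

/-- **Gaussian comparison between two centres** (pointwise): for `τ > 0`, `η > 0`, `σ = τ/(1+η)` and
points `y, x, p` of a real inner product space,
`(1+η)⁻² e^{-(1+η⁻¹)‖x-p‖²/(4τ)} · e^{-‖y-x‖²/(4σ)}/(4πσ)² ≤ e^{-‖y-p‖²/(4τ)}/(4πτ)²`.
Summing this over two centres `x₁, x₂` with midpoint `p` turns two separated nearly-full sheets
into Gaussian density `≈ 2` at `p`. [folklore] -/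
theorem gaussian_midpoint_comparison {E : Type*} [NormedAddCommGroup E] [InnerProductSpace ℝ E]
    (y x p : E) {τ η : ℝ} (hτ : 0 < τ) (hη : 0 < η) :
    (1 + η)⁻¹ ^ 2 * Real.exp (-((1 + η⁻¹) * ‖x - p‖ ^ 2) / (4 * τ)) *
        (Real.exp (-‖y - x‖ ^ 2 / (4 * (τ / (1 + η)))) / (4 * Real.pi * (τ / (1 + η))) ^ 2) ≤
      Real.exp (-‖y - p‖ ^ 2 / (4 * τ)) / (4 * Real.pi * τ) ^ 2 := by
  have hπ := Real.pi_pos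
  have hη1 : 0 < 1 + η := by linarith
  have hY := norm_sub_sq_le_midpoint y x p hη
  -- the prefactors agree: `(1+η)⁻² / (4π τ/(1+η))² = 1/(4πτ)²`
  have hpre : (1 + η)⁻¹ ^ 2 / (4 * Real.pi * (τ / (1 + η))) ^ 2 = 1 / (4 * Real.pi * τ) ^ 2 := by
    field_simp
  -- the exponents compare
  have hexp : Real.exp (-((1 + η⁻¹) * ‖x - p‖ ^ 2) / (4 * τ)) *
      Real.exp (-‖y - x‖ ^ 2 / (4 * (τ / (1 + η)))) ≤ Real.exp (-‖y - p‖ ^ 2 / (4 * τ)) := by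
    rw [← Real.exp_add]
    apply Real.exp_le_exp.2
    have h1 : -((1 + η⁻¹) * ‖x - p‖ ^ 2) / (4 * τ) + -‖y - x‖ ^ 2 / (4 * (τ / (1 + η))) =
        -((1 + η) * ‖y - x‖ ^ 2 + (1 + η⁻¹) * ‖x - p‖ ^ 2) / (4 * τ) := by
      field_simp
      ring
    rw [h1, neg_div, neg_div, neg_le_neg_iff]
    exact div_le_div_of_nonneg_right hY (by positivity)
  calc (1 + η)⁻¹ ^ 2 * Real.exp (-((1 + η⁻¹) * ‖x - p‖ ^ 2) / (4 * τ)) *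
        (Real.exp (-‖y - x‖ ^ 2 / (4 * (τ / (1 + η)))) / (4 * Real.pi * (τ / (1 + η))) ^ 2)
      = ((1 + η)⁻¹ ^ 2 / (4 * Real.pi * (τ / (1 + η))) ^ 2) *
          (Real.exp (-((1 + η⁻¹) * ‖x - p‖ ^ 2) / (4 * τ)) *
            Real.exp (-‖y - x‖ ^ 2 / (4 * (τ / (1 + η))))) := by ring
    _ ≤ (1 / (4 * Real.pi * τ) ^ 2) * Real.exp (-‖y - p‖ ^ 2 / (4 * τ)) := by
        rw [hpre]
        exact mul_le_mul_of_nonneg_left hexp (by positivity)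
    _ = _ := by ring

end Summit.SmoothPoincare4.SmoothPoincare4.Theorems.GaussianBounds

end
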